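import Summits.AtomisticToContinuum.Crystallization.Theorems.ChargedEnergyGapTwinWallsA
import HarnessLib

/-!
# «TwinWalls» (lens-3 g59 P-G(1/2), line 14231 ChargedEnergyGap) — part B (sequel of `…ChargedEnergyGapTwinWallsA`)

Split for the 400-line cap by the landing lane (hand-2 g29); the module docstring of part A describes the whole node.  Same namespace; all FQNs unchanged.
0 sorry; standard axioms.
-/

noncomputable section
open Literature.MathematicalPhysics.StatisticalMechanics
open Literature.Geometry.DiscreteGeometry
open Summit.AtomisticToContinuum.Crystallization.Theses.PricedLinkCensus
open Summit.AtomisticToContinuum.Crystallization.Theorems.ChargedEnergyGapNegative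

namespace Summit.AtomisticToContinuum.Crystallization.Theorems.ChargedEnergyGapChartDial

section TwinWalls


/-! ## §5 The laws, proved from the dictionary -/

section laws

variable {θ : ℝ} (hD : SlotDictionary θ) (hF : FccNoCis θ)
include hD hF

/-- ★★ (LC) **LAYER CONTINUATION**: co-layering is SYMMETRIC on clean matter — if `q` sits in an equatorial slot of the
clean hcp-charted site `p` and `q` is clean, then `q` is hcp-charted and `p` sits in an equatorial slot of `q`. -/
theorem equatorial_symm {Q : PeriodicConfiguration 3} {p q : Q.points} (hp : CleanAt Q θ p) (hq : CleanAt Q θ q)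
    (h : Equatorial Q θ p q) : Equatorial Q θ q p := by
  obtain ⟨A, hA, hslot⟩ := h
  have hcis : IsCisBond Q q p := (isCisBond_comm Q).1 ((hD Q p q A hp hA).1 hslot)
  rcases (chartedAt_iff_frame Q).1 hq.2 with ⟨A', hA'⟩ | ⟨A', hA'⟩
  · exact absurd hcis (hF Q q p A' hq hA')
  · exact ⟨A', hA', (hD Q q p A' hq hA').2 hcis⟩

/-- (LC) as an `Iff` between clean sites. -/
theorem equatorial_comm {Q : PeriodicConfiguration 3} {p q : Q.points} (hp : CleanAt Q θ p) (hq : CleanAt Q θ q) :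
    Equatorial Q θ p q ↔ Equatorial Q θ q p :=
  ⟨equatorial_symm hD hF hp hq, equatorial_symm hD hF hq hp⟩

/-- ★ (E3) **WALLS END ONLY AT UNCLEAN SITES**: if the clean wall site `p` has `q` in an equatorial slot but `q` does
not continue the wall (`p` is in no equatorial slot of `q`), then `q` is charged or uncharted — priced or gross matter. -/
theorem not_cleanAt_of_wall_end {Q : PeriodicConfiguration 3} {p q : Q.points} (hp : CleanAt Q θ p)
    (h : Equatorial Q θ p q) (hend : ¬ Equatorial Q θ q p) : ¬ CleanAt Q θ q :=
  fun hq => hend (equatorial_symm hD hF hp hq h)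

/-- (E3), spelled out: the rim site is charged or not `θ`-charted. -/
theorem charged_or_uncharted_of_wall_end {Q : PeriodicConfiguration 3} {p q : Q.points} (hp : CleanAt Q θ p)
    (h : Equatorial Q θ p q) (hend : ¬ Equatorial Q θ q p) :
    ¬ IsChargeFree (1 / 100) (Subtype.val : Q.points → E3) q ∨ ¬ ChartedAt θ Q q :=
  (not_cleanAt_iff Q).1 (not_cleanAt_of_wall_end hD hF hp h hend)

omit hF in
/-- ★ (FU) **ONE LAYER PER SITE**: the equatorial slots of a clean site do not depend on the hcp frame — a slot of one
frame is a slot of every frame. -/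
theorem inSlot_of_inSlot {Q : PeriodicConfiguration 3} {p q : Q.points} {A A' : E3 →ₗᵢ[ℝ] E3} (hp : CleanAt Q θ p)
    (hA : HcpFrame Q θ p A) (hA' : HcpFrame Q θ p A') (h : InSlot Q θ p q A) : InSlot Q θ p q A' :=
  (hD Q p q A' hp hA').2 ((hD Q p q A hp hA).1 h)

omit hF in
/-- (FU) restated: co-layering after a clean site can be read in ANY of its hcp frames. -/
theorem inSlot_of_equatorial {Q : PeriodicConfiguration 3} {p q : Q.points} {A' : E3 →ₗᵢ[ℝ] E3} (hp : CleanAt Q θ p)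
    (hA' : HcpFrame Q θ p A') (h : Equatorial Q θ p q) : InSlot Q θ p q A' := by
  obtain ⟨A, hA, hslot⟩ := h
  exact inSlot_of_inSlot hD hp hA hA' hslot

omit hD hF in
/-- An hcp frame has its six equatorial slots OCCUPIED: some point of `Q` sits in each (the matching is onto). -/
theorem exists_inSlot_of_hcpFrame {Q : PeriodicConfiguration 3} {p : Q.points} {A : E3 →ₗᵢ[ℝ] E3}
    (hA : HcpFrame Q θ p A) {v : E3} (hv : v ∈ hcpEquator) : ∃ q : Q.points, InSlot Q θ p q A := by
  obtain ⟨T, hT, e, he⟩ := hA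
  have hAv : A v ∈ hcpKissingPattern.image A := Finset.mem_image_of_mem _ (hcpEquator_subset hv)
  set t : ↥T := e.symm ⟨A v, hAv⟩ with ht
  have htT : (t : E3) ∈ shellSet Q p := by rw [← hT]; exact t.2
  obtain ⟨q, -, -, hq⟩ := (mem_shellSet_iff Q).1 htT
  refine ⟨q, v, hv, ?_⟩
  have h1 : dist (t : E3) (e t : E3) ≤ θ := he t
  rw [ht, Equiv.apply_symm_apply] at h1
  rw [hq]
  simpa [ht] using h1

/-- ★ (TE) **TYPE EXCLUSIVE**: a clean site is not both hcp- and fcc-framed (an hcp frame has an occupied equatorial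
slot, hence a cis bond; an fcc frame forbids cis bonds). -/
theorem not_fccFrame_of_hcpFrame {Q : PeriodicConfiguration 3} {p : Q.points} {A A' : E3 →ₗᵢ[ℝ] E3}
    (hp : CleanAt Q θ p) (hA : HcpFrame Q θ p A) : ¬ FccFrame Q θ p A' := by
  intro hA'
  have hv : ((Real.sqrt (18 : ℕ))⁻¹ • intVec ![3, -3, 0] : E3) ∈ hcpEquator :=
    Finset.mem_image_of_mem _ (by decide)
  obtain ⟨q, hq⟩ := exists_inSlot_of_hcpFrame hA hv
  exact hF Q p q A' hp hA' ((hD Q p q A hp hA).1 hq)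

/-- (TE) for the wall relation: a site after which something is co-layered has no fcc frame. -/
theorem not_fccFrame_of_equatorial {Q : PeriodicConfiguration 3} {p q : Q.points} {A' : E3 →ₗᵢ[ℝ] E3}
    (hp : CleanAt Q θ p) (h : Equatorial Q θ p q) : ¬ FccFrame Q θ p A' := by
  obtain ⟨A, hA, -⟩ := h
  exact not_fccFrame_of_hcpFrame hD hF hp hA

/-- ★★ (JX) **JUNCTION EXCLUSION AT AN INSPECTED COLUMN**: if the clean site `c` continues walls through the clean wall
sites `q₁` and `q₂` (it sits in an equatorial slot of each), then BOTH walls pass through `c` inside the ONE equatorial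
layer of `c`: for every hcp frame `A` of `c`, `q₁` and `q₂` occupy equatorial slots of `A`.  Around a clean column the
faces therefore pair into a single layer — `k ∈ {0, 2}`, the conclusion of (JE) read directly from the matter. -/
theorem walls_through_clean_site {Q : PeriodicConfiguration 3} {c q₁ q₂ : Q.points} (hc : CleanAt Q θ c)
    (hq₁ : CleanAt Q θ q₁) (hq₂ : CleanAt Q θ q₂) (h₁ : Equatorial Q θ q₁ c) (h₂ : Equatorial Q θ q₂ c)
    {A : E3 →ₗᵢ[ℝ] E3} (hA : HcpFrame Q θ c A) : InSlot Q θ c q₁ A ∧ InSlot Q θ c q₂ A :=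
  ⟨inSlot_of_equatorial hD hc hA (equatorial_symm hD hF hq₁ hc h₁),
    inSlot_of_equatorial hD hc hA (equatorial_symm hD hF hq₂ hc h₂)⟩

/-- (JX), frame-free form: walls entering a clean site leave it co-layered with each other's entry point — both `q₁` and
`q₂` are co-layered after `c`, and `c` is hcp-charted with no fcc frame. -/
theorem coLayered_of_common_site {Q : PeriodicConfiguration 3} {c q₁ q₂ : Q.points} (hc : CleanAt Q θ c)
    (hq₁ : CleanAt Q θ q₁) (hq₂ : CleanAt Q θ q₂) (h₁ : Equatorial Q θ q₁ c) (h₂ : Equatorial Q θ q₂ c) :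
    Equatorial Q θ c q₁ ∧ Equatorial Q θ c q₂ ∧ ∀ A' : E3 →ₗᵢ[ℝ] E3, ¬ FccFrame Q θ c A' :=
  ⟨equatorial_symm hD hF hq₁ hc h₁, equatorial_symm hD hF hq₂ hc h₂,
    fun _ => not_fccFrame_of_equatorial hD hF hc (equatorial_symm hD hF hq₁ hc h₁)⟩

/-- **THE WALL RELATION** on clean matter: both ends clean and co-layered.  Symmetric by (LC); its equivalence classes
(`Relation.EqvGen`) are the WALLS of `Q` at tolerance `θ`. -/
def WallAdj (θ : ℝ) (Q : PeriodicConfiguration 3) (p q : Q.points) : Prop :=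
  CleanAt Q θ p ∧ CleanAt Q θ q ∧ Equatorial Q θ p q

omit hD hF in
/-- Unfolding `WallAdj`. -/
theorem wallAdj_iff {Q : PeriodicConfiguration 3} {p q : Q.points} :
    WallAdj θ Q p q ↔ CleanAt Q θ p ∧ CleanAt Q θ q ∧ Equatorial Q θ p q := Iff.rfl

/-- ★ The wall relation is symmetric (layer continuation). -/
theorem wallAdj_symm {Q : PeriodicConfiguration 3} {p q : Q.points} (h : WallAdj θ Q p q) : WallAdj θ Q q p :=
  ⟨h.2.1, h.1, equatorial_symm hD hF h.1 h.2.1 h.2.2⟩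

/-- `WallAdj` is symmetric, as an `Iff`. -/
theorem wallAdj_comm {Q : PeriodicConfiguration 3} {p q : Q.points} : WallAdj θ Q p q ↔ WallAdj θ Q q p :=
  ⟨wallAdj_symm hD hF, wallAdj_symm hD hF⟩

/-- ★ (E1) **COMPLETENESS RELATIVE TO CLEAN MATTER**: every clean occupant of an equatorial slot of a wall site belongs to
the wall — a wall stops only where `CleanAt` fails. -/
theorem wallAdj_of_inSlot {Q : PeriodicConfiguration 3} {p q : Q.points} {A : E3 →ₗᵢ[ℝ] E3} (hp : CleanAt Q θ p)
    (hA : HcpFrame Q θ p A) (hq : CleanAt Q θ q) (h : InSlot Q θ p q A) : WallAdj θ Q p q ∧ WallAdj θ Q q p :=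
  have hpq : WallAdj θ Q p q := ⟨hp, hq, A, hA, h⟩
  ⟨hpq, wallAdj_symm hD hF hpq⟩

end laws

/-! ## §6 The record (`θ = 3/20`) and the reading for (N𝄪) -/

/-- The dictionary of record: X-D1 ∧ X-D2 at the chart tolerance `θ = 3/20` of parts A–K (a THEOREM:
`cleanLinkDictionaryRec_holds`, P-G(2/2)).  SUPPORT beneath (N𝄪) `LocalSeamReductionW` (P-D), cited by its proof exactly as
(T) `exists_adjacent_eq_of_prod_mem` and (JE) `length_eq_two_of_sector` are; it adds no hypothesis to (H𝄪). -/
def CleanLinkDictionaryRec : Prop := SlotDictionary (3 / 20) ∧ FccNoCis (3 / 20)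

/-- The record dictionary yields every law of §5 at `θ = 3/20` — e.g. layer continuation. -/
theorem equatorial_symm_rec (h : CleanLinkDictionaryRec) {Q : PeriodicConfiguration 3} {p q : Q.points}
    (hp : CleanAt Q (3 / 20) p) (hq : CleanAt Q (3 / 20) q) (hpq : Equatorial Q (3 / 20) p q) :
    Equatorial Q (3 / 20) q p :=
  equatorial_symm h.1 h.2 hp hq hpq

/-- … and junction exclusion at an inspected column. -/
theorem walls_through_clean_site_rec (h : CleanLinkDictionaryRec) {Q : PeriodicConfiguration 3}
    {c q₁ q₂ : Q.points} (hc : CleanAt Q (3 / 20) c) (hq₁ : CleanAt Q (3 / 20) q₁) (hq₂ : CleanAt Q (3 / 20) q₂)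
    (h₁ : Equatorial Q (3 / 20) q₁ c) (h₂ : Equatorial Q (3 / 20) q₂ c) {A : E3 →ₗᵢ[ℝ] E3}
    (hA : HcpFrame Q (3 / 20) c A) : InSlot Q (3 / 20) c q₁ A ∧ InSlot Q (3 / 20) c q₂ A :=
  walls_through_clean_site h.1 h.2 hc hq₁ hq₂ h₁ h₂ hA

end TwinWalls

end Summit.AtomisticToContinuum.Crystallization.Theorems.ChargedEnergyGapChartDial

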